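import Summits.CriticalPhenomena.PercolationContinuityZ3.Theorems.PercNearOneGluingNoHeavyLowerTailAntitheticParallel
import HarnessLib

/-!
# `NoHeavyLowerTail` (stmt-CriticalPhenomena-4575) — antithetic cluster pairs: the SEALING lemma and the one-step
# antitone criterion behind THEOREM I (cones), prim-hp-2 gen 35 (MEMO-gen35 §4b, THEOREM-I-cones.md Claims 1–2)

Support file (`--supports stmt-CriticalPhenomena-4575`, hull-port prover `prim-hp-2`, gen 35).  No definitions of record, no named
facts, no sorries; standard axioms.

THEOREM I (gen 35): if `s` is adjacent to every other vertex ("cone", apex `s`) then the antithetic bicluster-avoidance sum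
`Σ_{T : (W∩W')∩R = ∅} (f(W)−f(W'))(g(W)−g(W'))` is `≥ 0` for every `R`, by an explicit partition of the constraint set into pieces whose
blocks are the ZONES of the `R`-vertices.  Validity of these pieces is a SEALING argument, isolated here on the graph side (the first
graph-side lemma of the antithetic files; everything before was order-theoretic):

* `Antithetic.reachable_of_sealed` / `openCluster_subset_of_sealed` — if two bond configurations `ω, ω'` agree on every edge with both
  endpoints outside a vertex set `J ∌ s`, and `ω'` has NO open edge between `J` and its complement ("`J` is sealed in `ω'`"), then every
  vertex reachable from `s` in `ω'` is reachable in `ω` and lies outside `J`.  (Flipping a zone block to its "down" state seals the zone,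
  so the red cluster can only shrink: THEOREM-I-cones.md Claim 1; and the zone's `R`-vertex leaves the red cluster: Claim 2.)
* `Antithetic.openEdgeCluster_subset_of_sealed` — the same for BHK's open EDGE clusters (the form used by `piece_sum_nonneg`).
* `Antithetic.antitone_of_insert_le` — a set function on the subsets of a finite block set that does not increase when ONE block is added
  is antitone (so validity of a piece may be checked one flip at a time, as the machine checks of gen 32–35 do).
[cite: VandenbergHaggstromKahn2005, §1 p. 3 (open cluster `C_s`)]
-/

namespace Summit.CriticalPhenomena.PercolationContinuityZ3.Theorems

open Literature.Probability.Percolation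

namespace Antithetic

section Sealing

variable {V : Type*}

/-- **Sealing lemma (walk form).**  `ω, ω'` agree on edges with both endpoints outside `J`; `ω'` has no open edge from outside `J` into
`J`.  Then an `ω'`-open walk starting outside `J` stays outside `J` and is `ω`-open: its endpoint is `ω`-reachable and lies outside `J`.
[this work] -/
theorem reachable_of_sealed_walk (ω ω' : BondConfig V) (J : Set V)
    (hagree : ∀ x y, x ∉ J → y ∉ J → (s(x, y) ∈ ω' ↔ s(x, y) ∈ ω))
    (hseal : ∀ x y, x ∉ J → y ∈ J → s(x, y) ∉ ω') :
    ∀ {u x : V} (_ : (openGraph ω').Walk u x), u ∉ J → (openGraph ω).Reachable u x ∧ x ∉ J := by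
  intro u x p
  induction p with
  | nil => exact fun hu => ⟨SimpleGraph.Reachable.refl _, hu⟩
  | @cons a b c hab _ ih =>
    intro ha
    rw [openGraph_adj] at hab
    have hb : b ∉ J := fun hbJ => hseal a b ha hbJ hab.1
    have hab' : (openGraph ω).Adj a b := by
      rw [openGraph_adj]
      exact ⟨(hagree a b ha hb).1 hab.1, hab.2⟩
    obtain ⟨hbc, hc⟩ := ih hb
    exact ⟨hab'.reachable.trans hbc, hc⟩

/-- **Sealing lemma.**  If `s ∉ J`, `ω` and `ω'` agree on all edges with both endpoints outside `J`, and `J` is sealed in `ω'` (no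
`ω'`-open edge between `V ∖ J` and `J`), then every vertex `ω'`-reachable from `s` is `ω`-reachable from `s` and lies outside `J`.
[this work] -/
theorem reachable_of_sealed (ω ω' : BondConfig V) (s : V) (J : Set V) (hs : s ∉ J)
    (hagree : ∀ x y, x ∉ J → y ∉ J → (s(x, y) ∈ ω' ↔ s(x, y) ∈ ω))
    (hseal : ∀ x y, x ∉ J → y ∈ J → s(x, y) ∉ ω') {x : V} (hx : (openGraph ω').Reachable s x) :
    (openGraph ω).Reachable s x ∧ x ∉ J := by
  obtain ⟨p⟩ := hx
  exact reachable_of_sealed_walk ω ω' J hagree hseal p hs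

/-- Sealing, cluster form: under the hypotheses of `reachable_of_sealed` the open (vertex) cluster of `s` in `ω'` is contained in the
one in `ω` and misses `J`. [this work] -/
theorem openCluster_subset_of_sealed (ω ω' : BondConfig V) (s : V) (J : Set V) (hs : s ∉ J)
    (hagree : ∀ x y, x ∉ J → y ∉ J → (s(x, y) ∈ ω' ↔ s(x, y) ∈ ω))
    (hseal : ∀ x y, x ∉ J → y ∈ J → s(x, y) ∉ ω') :
    openCluster ω' s ⊆ openCluster ω s ∧ Disjoint (openCluster ω' s) J := by
  refine ⟨fun x hx => (reachable_of_sealed ω ω' s J hs hagree hseal hx).1, ?_⟩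
  exact Set.disjoint_left.2 fun x hx hxJ => (reachable_of_sealed ω ω' s J hs hagree hseal hx).2 hxJ

/-- Sealing for BHK's open EDGE cluster `C_s` (the set of open edges both of whose endpoints are joined to `s`): under the hypotheses
of `reachable_of_sealed`, `C_s(ω') ⊆ C_s(ω)`. [cite: VandenbergHaggstromKahn2005, §1 p. 3 (open cluster `C_s`)] -/
theorem openEdgeCluster_subset_of_sealed (ω ω' : BondConfig V) (s : V) (J : Set V) (hs : s ∉ J)
    (hagree : ∀ x y, x ∉ J → y ∉ J → (s(x, y) ∈ ω' ↔ s(x, y) ∈ ω))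
    (hseal : ∀ x y, x ∉ J → y ∈ J → s(x, y) ∉ ω') :
    openEdgeCluster ω' s ⊆ openEdgeCluster ω s := by
  intro e he
  rw [mem_openEdgeCluster_iff] at he ⊢
  obtain ⟨heω', hdiag, hreach⟩ := he
  have hout : ∀ v ∈ e, (openGraph ω).Reachable s v ∧ v ∉ J :=
    fun v hv => reachable_of_sealed ω ω' s J hs hagree hseal (hreach v hv)
  refine ⟨?_, hdiag, fun v hv => (hout v hv).1⟩
  induction e using Sym2.ind with
  | h x y =>
    exact (hagree x y (hout x (Sym2.mem_mk_left x y)).2 (hout y (Sym2.mem_mk_right x y)).2).1 heω'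

end Sealing

section OneStep

variable {β : Type*} [Finite β] {α : Type*} [Preorder α]

/-- **One-step antitone criterion.**  A function of the subsets of a finite set that does not increase when one element is inserted is
antitone.  (Validity of a piece — the red cluster is antitone in the set of flipped blocks — may therefore be checked one block at a
time.) [folklore] -/
theorem antitone_of_insert_le (Φ : Set β → α) (h : ∀ (S : Set β) (b : β), b ∉ S → Φ (insert b S) ≤ Φ S) : Antitone Φ := by
  intro S S' hSS'
  have key : ∀ D : Set β, D.Finite → Φ (S ∪ D) ≤ Φ S := by
    intro D hD
    induction D, hD using Set.Finite.induction_on with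
    | empty => simp
    | @insert b D hbD _ ih =>
      by_cases hb : b ∈ S ∪ D
      · have : S ∪ insert b D = S ∪ D := by
          rw [Set.union_insert, Set.insert_eq_of_mem hb]
        rw [this]; exact ih
      · rw [Set.union_insert]
        exact (h _ b hb).trans ih
  have hfin : (S' \ S).Finite := Set.toFinite _
  have := key (S' \ S) hfin
  rwa [Set.union_sdiff_cancel hSS'] at this

end OneStep

end Antithetic

end Summit.CriticalPhenomena.PercolationContinuityZ3.Theorems
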